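import Literature.NumberTheory.Automorphic.RootDataRootsFiniteProofs
import HarnessLib

/-!
# Commutator relations among root subgroups (Springer 8.2.3) and solvability of `T · U⁺`
(trunk T-AUTOMORPHIC, G25 AutomorphicL)

Companion to `RootData.lean` (namespace `Literature.Automorphic`, `k`-points vocabulary of items I1–I2:
root homomorphisms `IsRootHom`, root subgroups `rootSubgroup G T α = U_α`, root data
`IsRootDatumOf G T P eX eY` with Mathlib's `RootPairing` / `RootPairing.Base`). It serves the
solvability clause of Springer 8.2.4 (i) (*`T` and the `U_α`, `α ∈ R̃⁺`, generate a Borel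
subgroup*; named fact `isSolvable_borelOfBase` of `ReductiveDualChevalleyBasedProofs.lean`):

* `rootSubgroup_commutator_le` — **Springer 8.2.3, the commutator relations**, vendored as a
  named fact (D-0014) in corollary form: for roots `α ≠ ±β`, `(U_α, U_β)` lies in the subgroup
  generated by the `U_{aα + cβ}`, `a, c > 0` (printed: `(u_α(x), u_β(y)) = ∏ u_{iα+jβ}(c xⁱ yʲ)`;
  its proof needs 8.2.1, i.e. Ch. 7);
* proved: `T` normalises every `U_α` (`le_normalizer_rootSubgroup`, from
  `t u(x) t⁻¹ = u(α(t) x)`); group theory of commutators of joins (`commutator_iSup_iSup_le`: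
  if `K_i`, `L_j` normalise `N` and `⁅K_i, L_j⁆ ≤ N` then `⁅⨆ K_i, ⨆ L_j⁆ ≤ N`) and an ambient
  derived series `derivedSub` (`isSolvable_of_derivedSub_eq_bot`);
* proved: the height filtration `heightFiltration G T eX b m = U_m = ⟨U_α : α > 0, ht α ≥ m⟩` of a
  base `b` (Springer 8.2.4, proof), heights of positive combinations
  (`isPos_and_le_height_of_root_eq`, 7.4.5 (c)), and — **granted 8.1.1 (i)
  (`rootSubgroup_unique`, so that `U_α ≅ 𝔾ₐ` is commutative) and 8.2.3** —
  `(U_α, U_β) ≤ U_{ht α + ht β}`, `(U_m, U_m) ≤ U_{m+1}`, whence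
  **`isSolvable_iSup_rootSubgroup_of`** (`U⁺ = ⟨U_α : α ∈ R⁺(b)⟩` is solvable: its derived
  series descends the finite height filtration) and **`isSolvable_sup_iSup_rootSubgroup_of`**
  (`T ⊔ U⁺` is solvable: `T` is commutative and normalises `U⁺`). Finiteness of the index type
  comes from `roots_finite_holds` (`IsRootDatumOf.finite_index`).

Springer obtains more (each `U_n` is a closed connected *unipotent* group, via 8.2.2); solvability
is what `IsBorelIn` asks for.

## References

* T. A. Springer, *Linear Algebraic Groups*, 2nd ed., Progress in Mathematics 9, Birkhäuser
  (1998), 7.4.3, 7.4.5, 8.1.1 (i), 8.2.1–8.2.3, 8.2.4 (i) and its proof.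
-/

open scoped IsMulCommutative MatrixGroups Pointwise commutatorElement

namespace Literature.NumberTheory.Automorphic

/-! ### Group theory: commutators of joins, an ambient derived series -/

section GroupTheory

variable {Γ : Type*} [Group Γ]

/-- The elements `g` normalising `N` whose commutators with a subgroup `Z` lie in `N` form a
subgroup (`⁅x y, z⁆ = x ⁅y, z⁆ x⁻¹ ⁅x, z⁆`, `⁅x⁻¹, z⁆ = x⁻¹ ⁅x, z⁆⁻¹ x`). [folklore] -/
def commutatorInto (N Z : Subgroup Γ) : Subgroup Γ where
  carrier := {g | g ∈ Subgroup.normalizer (N : Set Γ) ∧ ∀ z ∈ Z, ⁅g, z⁆ ∈ N}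
  one_mem' := ⟨(Subgroup.normalizer (N : Set Γ)).one_mem, fun z _ => by simp⟩
  mul_mem' := by
    rintro x y ⟨hxN, hx⟩ ⟨hyN, hy⟩
    refine ⟨(Subgroup.normalizer (N : Set Γ)).mul_mem hxN hyN, fun z hz => ?_⟩
    have hid : ⁅x * y, z⁆ = x * ⁅y, z⁆ * x⁻¹ * ⁅x, z⁆ := by
      simp only [commutatorElement_def]; group
    rw [hid]
    refine N.mul_mem ?_ (hx z hz)
    exact (Subgroup.mem_normalizer_iff.1 hxN _).1 (hy z hz)
  inv_mem' := by
    rintro x ⟨hxN, hx⟩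
    refine ⟨(Subgroup.normalizer (N : Set Γ)).inv_mem hxN, fun z hz => ?_⟩
    have hid : ⁅x⁻¹, z⁆ = x⁻¹ * ⁅x, z⁆⁻¹ * x⁻¹⁻¹ := by
      simp only [commutatorElement_def]; group
    rw [hid]
    exact (Subgroup.mem_normalizer_iff.1 ((Subgroup.normalizer (N : Set Γ)).inv_mem hxN) _).1
      (N.inv_mem (hx z hz))

/-- Membership in `commutatorInto`. [folklore] -/
lemma mem_commutatorInto {N Z : Subgroup Γ} {g : Γ} :
    g ∈ commutatorInto N Z ↔ g ∈ Subgroup.normalizer (N : Set Γ) ∧ ∀ z ∈ Z, ⁅g, z⁆ ∈ N := Iff.rfl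

/-- **Commutators of joins**: if subgroups `K_i`, `L_j` normalise `N` and `⁅K_i, L_j⁆ ≤ N` for all
`i, j`, then `⁅⨆ K_i, ⨆ L_j⁆ ≤ N`. [folklore] -/
theorem commutator_iSup_iSup_le {ι₁ ι₂ : Sort*} {K : ι₁ → Subgroup Γ} {L : ι₂ → Subgroup Γ}
    {N : Subgroup Γ} (hK : ∀ i, K i ≤ Subgroup.normalizer (N : Set Γ))
    (hL : ∀ j, L j ≤ Subgroup.normalizer (N : Set Γ))
    (h : ∀ i j, ⁅K i, L j⁆ ≤ N) : ⁅⨆ i, K i, ⨆ j, L j⁆ ≤ N := by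
  -- first `⁅⨆ K, L j⁆ ≤ N` for each `j`
  have h1 : ∀ j, (⨆ i, K i) ≤ commutatorInto N (L j) := fun j =>
    iSup_le fun i g hg => ⟨hK i hg, fun z hz =>
      h i j (Subgroup.commutator_mem_commutator hg hz)⟩
  -- then `⨆ L ≤ commutatorInto N (⨆ K)` using `⁅z, g⁆ = ⁅g, z⁆⁻¹`
  have h2 : (⨆ j, L j) ≤ commutatorInto N (⨆ i, K i) := iSup_le fun j z hz =>
    ⟨hL j hz, fun g hg => by
      rw [← commutatorElement_inv, inv_mem_iff]
      exact ((h1 j) hg).2 z hz⟩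
  rw [Subgroup.commutator_le]
  intro g hg z hz
  rw [← commutatorElement_inv, inv_mem_iff]
  exact (h2 hz).2 g hg

/-- If `H` normalises `N` then `⁅H, N⁆ ≤ N` (one direction of Mathlib's
`Subgroup.le_normalizer_iff_commutator_le_right`, kept as a named alias). [folklore] -/
theorem commutator_le_of_le_normalizer {H N : Subgroup Γ}
    (h : H ≤ Subgroup.normalizer (N : Set Γ)) :
    ⁅H, N⁆ ≤ N :=
  Subgroup.le_normalizer_iff_commutator_le_right.mp h

/-- An element mapping `H` into itself under conjugation by itself and by its inverse normalises
`H`. [folklore] -/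
theorem mem_normalizer_of_map_conj_le {H : Subgroup Γ} {g : Γ}
    (h₁ : H.map (MulAut.conj g).toMonoidHom ≤ H) (h₂ : H.map (MulAut.conj g⁻¹).toMonoidHom ≤ H) :
    g ∈ Subgroup.normalizer (H : Set Γ) := by
  rw [Subgroup.mem_normalizer_iff]
  intro x
  constructor
  · intro hx
    exact h₁ ⟨x, hx, rfl⟩
  · intro hx
    have : g⁻¹ * (g * x * g⁻¹) * g⁻¹⁻¹ ∈ H := h₂ ⟨_, hx, rfl⟩
    simpa [mul_assoc] using this

/-- The derived series of a subgroup `H ≤ Γ`, as subgroups of `Γ`: `D⁰ = H`,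
`Dᵐ⁺¹ = ⁅Dᵐ, Dᵐ⁆`. [folklore] -/
def derivedSub (H : Subgroup Γ) : ℕ → Subgroup Γ
  | 0 => H
  | m + 1 => ⁅derivedSub H m, derivedSub H m⁆

/-- `D⁰ H = H`. [folklore] -/
@[simp] lemma derivedSub_zero (H : Subgroup Γ) : derivedSub H 0 = H := rfl

/-- `Dᵐ⁺¹ H = ⁅Dᵐ H, Dᵐ H⁆`. [folklore] -/
lemma derivedSub_succ (H : Subgroup Γ) (m : ℕ) :
    derivedSub H (m + 1) = ⁅derivedSub H m, derivedSub H m⁆ := rfl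

/-- `derivedSub` is Mathlib's `derivedSeries` of `↥H` pushed into `Γ`. [folklore] -/
theorem map_derivedSeries_subtype (H : Subgroup Γ) (m : ℕ) :
    (derivedSeries ↥H m).map H.subtype = derivedSub H m := by
  induction m with
  | zero => simp [← MonoidHom.range_eq_map]
  | succ m ih => rw [derivedSeries_succ, Subgroup.map_commutator, ih, derivedSub_succ]

/-- A subgroup whose ambient derived series reaches `⊥` is solvable. [folklore] -/
theorem isSolvable_of_derivedSub_eq_bot {H : Subgroup Γ} {m : ℕ} (h : derivedSub H m = ⊥) :
    IsSolvable ↥H := by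
  refine ⟨⟨m, ?_⟩⟩
  have := map_derivedSeries_subtype H m
  rwa [h, Subgroup.map_eq_bot_iff_of_injective _ H.subtype_injective] at this

/-- `⁅H, H⁆ ≤ K` propagates along the derived series: `Dᵐ⁺¹ H ≤ Dᵐ K`. [folklore] -/
theorem derivedSub_succ_le_of_commutator_le {H K : Subgroup Γ} (h : ⁅H, H⁆ ≤ K) (m : ℕ) :
    derivedSub H (m + 1) ≤ derivedSub K m := by
  induction m with
  | zero => simpa [derivedSub_succ] using h
  | succ m ih =>
    rw [derivedSub_succ, derivedSub_succ K]
    exact Subgroup.commutator_mono ih ih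

end GroupTheory

variable {k : Type*} [Field k] {n : Type*} [Fintype n] [DecidableEq n]

/-! ### `T` normalises the root subgroups -/

section Normalizer

variable {G T : Subgroup (GL n k)}

/-- Conjugation by `t ∈ T` maps each root subgroup `U_α` into itself:
`t u(x) t⁻¹ = u(α(t) x)` (Springer 8.1.1 (i)). [folklore] -/
theorem map_conj_rootSubgroup_le (α : ↥T →* kˣ) {t : GL n k} (ht : t ∈ T) :
    (rootSubgroup G T α).map (MulAut.conj t).toMonoidHom ≤ rootSubgroup G T α := by
  unfold rootSubgroup
  simp only [Subgroup.map_iSup]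
  refine iSup_le fun hTG => iSup_le fun u => iSup_le fun hu => ?_
  refine le_trans ?_ (le_iSup_of_le hTG (le_iSup₂_of_le u hu le_rfl))
  rintro _ ⟨_, ⟨_, ⟨x, rfl⟩, rfl⟩, rfl⟩
  refine ⟨u (Multiplicative.ofAdd ((α ⟨t, ht⟩ : k) * x.toAdd)), ⟨_, rfl⟩, ?_⟩
  have h := congrArg Subtype.val (hu.2.2 ⟨t, ht⟩ x.toAdd)
  simp only [ofAdd_toAdd, Subgroup.coe_mul, Subgroup.coe_inv, Subgroup.coe_inclusion] at h
  simpa [MulAut.conj_apply] using h.symm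

/-- `T` normalises every root subgroup `U_α` (Springer 8.1.1 (i)). [folklore] -/
theorem le_normalizer_rootSubgroup (α : ↥T →* kˣ) :
    T ≤ Subgroup.normalizer (rootSubgroup G T α : Set (GL n k)) :=
  fun _ ht => mem_normalizer_of_map_conj_le (map_conj_rootSubgroup_le α ht)
    (map_conj_rootSubgroup_le α (T.inv_mem ht))

end Normalizer

/-! ### The commutator relations (Springer 8.2.3), corollary form -/

section CommutatorRelations

variable {ι X Y : Type*} [AddCommGroup X] [AddCommGroup Y]
variable {G T : Subgroup (GL n k)} [IsMulCommutative ↥T]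

/-- **Springer 8.2.3 (the commutator relations), corollary form.** Let `G` be connected reductive
over an algebraically closed field, `T` a maximal torus, `P` the root datum of `(G, T)` (through
`eX`, `eY`) and `α = α_i`, `β = α_j` roots with `α ≠ ±β`. Printed statement: *there exist constants
`c_{α,β;i,j} ∈ k` such that `(u_α(x), u_β(y)) = ∏_{iα+jβ ∈ R; i,j>0} u_{iα+jβ}(c_{α,β;i,j} xⁱ yʲ)`
(`x, y ∈ k`), the order of the factors being prescribed by the ordering of `R`*. Vendored here is
its corollary on subgroups (what 8.2.4 (i) uses): the commutator group `(U_α, U_β)` is contained in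
the subgroup generated by the root subgroups `U_{aα + cβ}` with `a, c > 0` and `aα + cβ ∈ R`.
Named fact (D-0014); the printed proof rests on 8.2.1 (via 7.1–7.6: centralisers of singular
tori, groups of semisimple rank `≤ 2`) and 8.1.12. [cite: SpringerLAG1998, Prop 8.2.3] -/
def rootSubgroup_commutator_le : Prop :=
  ∀ [IsAlgClosed k] (_hG : IsConnectedReductive G) (_hT : IsMaximalTorusIn T G)
    {P : RootPairing ι ℤ X Y} {eX : Additive ↥(characterLattice T) ≃+ X}
    {eY : Additive ↥(cocharacterLattice T) ≃+ Y} (_h : IsRootDatumOf G T P eX eY) (i j : ι),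
    P.root i ≠ P.root j → P.root i ≠ -P.root j →
      ⁅rootSubgroup G T (charOfWeight eX (P.root i)),
          rootSubgroup G T (charOfWeight eX (P.root j))⁆ ≤
        ⨆ (m : ι) (_ : ∃ a c : ℕ, 0 < a ∧ 0 < c ∧ P.root m = a • P.root i + c • P.root j),
          rootSubgroup G T (charOfWeight eX (P.root m))

end CommutatorRelations


/-! ### `T · U⁺` is solvable, from 8.1.1 (i) and 8.2.3 -/

section Solvable

variable {ι X Y : Type*} [AddCommGroup X] [AddCommGroup Y]
variable {G T : Subgroup (GL n k)}
variable {P : RootPairing ι ℤ X Y} {eX : Additive ↥(characterLattice T) ≃+ X}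

/-! #### Heights of positive roots -/

section Heights

variable (b : P.Base)

/-- Positive roots are not opposite to each other. [folklore] -/
lemma root_ne_neg_root_of_isPos {i j : ι} (hi : b.IsPos i) (hj : b.IsPos j) :
    P.root i ≠ -P.root j := by
  intro hij
  letI := P.indexNeg
  have hneg : P.root (-j) = -P.root j := by
    change P.root (P.reflectionPerm j j) = -P.root j
    rw [P.root_reflectionPerm, P.reflection_apply_self]
  have heq : i = -j := P.root.injective (by rw [hneg, hij])
  have h1 : b.height i = -b.height j := by rw [heq]; exact b.height_reflectionPerm_self j
  rw [RootPairing.Base.isPos_iff] at hi hj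
  omega

/-- The height of `a α_i + c α_j` is `a ht(α_i) + c ht(α_j)`. [folklore] -/
lemma height_eq_of_root_eq_smul_add_smul {i j m : ι} {a c : ℕ}
    (hm : P.root m = a • P.root i + c • P.root j) :
    b.height m = a * b.height i + c * b.height j := by
  obtain ⟨f, -, -, hf⟩ := b.exists_root_eq_sum_int i
  obtain ⟨g, -, -, hg⟩ := b.exists_root_eq_sum_int j
  have hfg : P.root m = ∑ l ∈ b.support, ((a : ℤ) • f + (c : ℤ) • g) l • P.root l := by
    simp_rw [Pi.add_apply, Pi.smul_apply, add_smul, smul_assoc, Finset.sum_add_distrib,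
      ← Finset.smul_sum, ← hf, ← hg, hm, Nat.cast_smul_eq_nsmul]
  simp_rw [RootPairing.Base.height_eq_sum hf, RootPairing.Base.height_eq_sum hg,
    RootPairing.Base.height_eq_sum hfg, Pi.add_apply, Pi.smul_apply, Finset.sum_add_distrib,
    smul_eq_mul, ← Finset.mul_sum]

/-- A positive combination of positive roots is positive, of height at least the sum of the
heights (Springer 7.4.5 (c)). [folklore] -/
lemma isPos_and_le_height_of_root_eq {i j m : ι} (hi : b.IsPos i) (hj : b.IsPos j) {a c : ℕ}
    (ha : 0 < a) (hc : 0 < c) (hm : P.root m = a • P.root i + c • P.root j) :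
    b.IsPos m ∧ b.height i + b.height j ≤ b.height m := by
  have h := height_eq_of_root_eq_smul_add_smul b hm
  rw [RootPairing.Base.isPos_iff] at hi hj ⊢
  constructor <;> nlinarith

end Heights

/-! #### The height filtration `U_m = ⟨U_α : α > 0, ht α ≥ m⟩` -/

variable (G T eX) in
/-- The subgroup `U_m = ⟨U_α : α ∈ R⁺(b), ht(α) ≥ m⟩` generated by the root subgroups of the
positive roots of height at least `m` (Springer 8.2.4, proof: the groups `U_n`). [folklore] -/
def heightFiltration (b : P.Base) (m : ℤ) : Subgroup (GL n k) :=
  ⨆ x : {i : ι // b.IsPos i ∧ m ≤ b.height i}, rootSubgroup G T (charOfWeight eX (P.root x.1))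

variable (b : P.Base)

/-- `U_m` is antitone in `m`. [folklore] -/
lemma heightFiltration_mono {m m' : ℤ} (hmm' : m ≤ m') :
    heightFiltration G T eX b m' ≤ heightFiltration G T eX b m :=
  iSup_le fun x => le_iSup_of_le (f := fun y : {i : ι // b.IsPos i ∧ m ≤ b.height i} =>
    rootSubgroup G T (charOfWeight eX (P.root y.1))) ⟨x.1, x.2.1, hmm'.trans x.2.2⟩ le_rfl

/-- `U_α ≤ U_m` for `α` positive of height `≥ m`. [folklore] -/
lemma rootSubgroup_le_heightFiltration {i : ι} (hi : b.IsPos i) {m : ℤ} (hm : m ≤ b.height i) :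
    rootSubgroup G T (charOfWeight eX (P.root i)) ≤ heightFiltration G T eX b m :=
  le_iSup_of_le (f := fun y : {i : ι // b.IsPos i ∧ m ≤ b.height i} =>
    rootSubgroup G T (charOfWeight eX (P.root y.1))) ⟨i, hi, hm⟩ le_rfl

/-- `U_1 = ⟨U_α : α > 0⟩` is the group generated by all positive root subgroups. [folklore] -/
lemma heightFiltration_one :
    heightFiltration G T eX b 1 =
      ⨆ (i : ι) (_ : b.IsPos i), rootSubgroup G T (charOfWeight eX (P.root i)) := by
  rw [heightFiltration, iSup_subtype']
  refine le_antisymm (iSup_le fun x => ?_) (iSup_le fun x => ?_)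
  · exact le_iSup_of_le (f := fun y : {i : ι // b.IsPos i} =>
      rootSubgroup G T (charOfWeight eX (P.root y.1))) ⟨x.1, x.2.1⟩ le_rfl
  · exact le_iSup_of_le (f := fun y : {i : ι // b.IsPos i ∧ 1 ≤ b.height i} =>
      rootSubgroup G T (charOfWeight eX (P.root y.1))) ⟨x.1, x.2, x.2⟩ le_rfl

/-- `T` normalises each `U_m`. [folklore] -/
lemma le_normalizer_heightFiltration (m : ℤ) :
    T ≤ Subgroup.normalizer (heightFiltration G T eX b m : Set (GL n k)) := by
  intro t ht
  have key : ∀ s ∈ T, (heightFiltration G T eX b m).map (MulAut.conj s).toMonoidHom ≤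
      heightFiltration G T eX b m := fun s hs => by
    rw [heightFiltration, Subgroup.map_iSup]
    exact iSup_mono fun x => map_conj_rootSubgroup_le _ hs
  exact mem_normalizer_of_map_conj_le (key t ht) (key t⁻¹ (T.inv_mem ht))

/-- For `m` beyond all heights, `U_m` is trivial. [folklore] -/
lemma heightFiltration_eq_bot {m : ℤ} (hm : ∀ i, b.height i < m) :
    heightFiltration G T eX b m = ⊥ := by
  haveI : IsEmpty {i : ι // b.IsPos i ∧ m ≤ b.height i} :=
    ⟨fun x => absurd x.2.2 (not_le.2 (hm x.1))⟩
  rw [heightFiltration, iSup_of_empty]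

section RootDatum

variable [IsMulCommutative ↥T] {eY : Additive ↥(cocharacterLattice T) ≃+ Y}

/-- The index type of a root datum of `(G, T)` is finite: the roots of a connected reductive group
are finite in number (`roots_finite_holds`, Springer 7.4.3). [folklore] -/
theorem IsRootDatumOf.finite_index [IsAlgClosed k] (hG : IsConnectedReductive G)
    (hT : IsMaximalTorusIn T G) (h : IsRootDatumOf G T P eX eY) : Finite ι := by
  have hfin : (Set.range P.root).Finite := by
    rw [h.range_root]
    exact (roots_finite_holds hG hT).image _
  haveI := hfin.to_subtype
  exact Finite.of_injective_finite_range P.root.injective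

/-- Each character `α_i = eX⁻¹ (P.root i)` is a root of `(G, T)`. [folklore] -/
theorem IsRootDatumOf.exists_root_eq (h : IsRootDatumOf G T P eX eY) (i : ι) :
    ∃ α ∈ roots G T, (α : ↥T →* kˣ) = charOfWeight eX (P.root i) := by
  have : P.root i ∈ Set.range P.root := ⟨i, rfl⟩
  rw [h.range_root] at this
  obtain ⟨α, hα, hαi⟩ := this
  refine ⟨α, hα, ?_⟩
  simp [charOfWeight, ← hαi]

/-- Granted Springer 8.1.1 (i) (`rootSubgroup_unique`), the root subgroup `U_{α_i}` is the image of
the root homomorphism `φ_i ∘ (x ↦ [[1, x], [0, 1]])` supplied by the root datum. [folklore] -/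
theorem IsRootDatumOf.rootSubgroup_eq_map_range [IsAlgClosed k]
    (hU : rootSubgroup_unique (G := G) (T := T)) (hG : IsConnectedReductive G)
    (hT : IsMaximalTorusIn T G) (h : IsRootDatumOf G T P eX eY) (i : ι) :
    rootSubgroup G T (charOfWeight eX (P.root i)) =
      ((h.exists_sl2Hom i).choose.comp unipotentUpperSL2).range.map G.subtype := by
  obtain ⟨α, hα, hαi⟩ := h.exists_root_eq i
  have hu := (h.exists_sl2Hom i).choose_spec.2.1
  have key := hU hG hT hα (u := (h.exists_sl2Hom i).choose.comp unipotentUpperSL2)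
    (by rw [hαi]; exact hu)
  rw [hαi] at key
  exact key.symm

/-- Granted 8.1.1 (i), root subgroups are commutative (images of `𝔾ₐ`). [folklore] -/
theorem IsRootDatumOf.commutator_rootSubgroup_self [IsAlgClosed k]
    (hU : rootSubgroup_unique (G := G) (T := T)) (hG : IsConnectedReductive G)
    (hT : IsMaximalTorusIn T G) (h : IsRootDatumOf G T P eX eY) (i : ι) :
    ⁅rootSubgroup G T (charOfWeight eX (P.root i)), rootSubgroup G T (charOfWeight eX (P.root i))⁆ =
      ⊥ := by
  rw [Subgroup.commutator_self_eq_bot_iff, h.rootSubgroup_eq_map_range hU hG hT i]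
  -- the image of the commutative group `𝔾ₐ`
  infer_instance

variable [IsAlgClosed k]

/-- **The commutator relations bound commutators by height**: granted 8.2.3
(`rootSubgroup_commutator_le`), for distinct positive roots `α, β` one has
`(U_α, U_β) ≤ U_{ht α + ht β}`. [folklore] -/
theorem commutator_rootSubgroup_le_heightFiltration
    (hC : rootSubgroup_commutator_le (G := G) (T := T) (ι := ι) (X := X) (Y := Y))
    (hG : IsConnectedReductive G) (hT : IsMaximalTorusIn T G) (h : IsRootDatumOf G T P eX eY)
    {i j : ι} (hi : b.IsPos i) (hj : b.IsPos j) (hij : i ≠ j) :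
    ⁅rootSubgroup G T (charOfWeight eX (P.root i)), rootSubgroup G T (charOfWeight eX (P.root j))⁆ ≤
      heightFiltration G T eX b (b.height i + b.height j) := by
  refine (hC hG hT h i j (fun hEq => hij (P.root.injective hEq))
    (root_ne_neg_root_of_isPos b hi hj)).trans (iSup₂_le fun m hm => ?_)
  obtain ⟨a, c, ha, hc, hm⟩ := hm
  obtain ⟨hmpos, hmht⟩ := isPos_and_le_height_of_root_eq b hi hj ha hc hm
  exact rootSubgroup_le_heightFiltration b hmpos hmht

/-- Granted 8.2.3: every positive root subgroup normalises each `U_m`. [folklore] -/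
theorem rootSubgroup_le_normalizer_heightFiltration
    (hC : rootSubgroup_commutator_le (G := G) (T := T) (ι := ι) (X := X) (Y := Y))
    (hG : IsConnectedReductive G) (hT : IsMaximalTorusIn T G) (h : IsRootDatumOf G T P eX eY)
    {i : ι} (hi : b.IsPos i) (m : ℤ) :
    rootSubgroup G T (charOfWeight eX (P.root i)) ≤
      Subgroup.normalizer (heightFiltration G T eX b m : Set (GL n k)) := by
  intro g hg
  -- conjugation by `g ∈ U_α` maps each `U_β` (`β > 0`, `ht β ≥ m`) into `U_m`
  have key : ∀ g ∈ rootSubgroup G T (charOfWeight eX (P.root i)),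
      (heightFiltration G T eX b m).map (MulAut.conj g).toMonoidHom ≤
        heightFiltration G T eX b m := by
    intro g hg
    rw [heightFiltration, Subgroup.map_iSup]
    refine iSup_le fun x => ?_
    rintro _ ⟨y, hy, rfl⟩
    change g * y * g⁻¹ ∈ heightFiltration G T eX b m
    have hyx : y ∈ heightFiltration G T eX b m := rootSubgroup_le_heightFiltration b x.2.1 x.2.2 hy
    by_cases hix : i = x.1
    · subst hix
      exact (heightFiltration G T eX b m).mul_mem ((heightFiltration G T eX b m).mul_mem
        (rootSubgroup_le_heightFiltration b x.2.1 x.2.2 hg) hyx)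
        ((heightFiltration G T eX b m).inv_mem (rootSubgroup_le_heightFiltration b x.2.1 x.2.2 hg))
    · have hc : ⁅g, y⁆ ∈ heightFiltration G T eX b m := by
        refine heightFiltration_mono b ?_
          (commutator_rootSubgroup_le_heightFiltration b hC hG hT h hi x.2.1 hix
            (Subgroup.commutator_mem_commutator hg hy))
        have := (RootPairing.Base.isPos_iff b).1 hi
        linarith [x.2.2]
      have : g * y * g⁻¹ = ⁅g, y⁆ * y := by simp [commutatorElement_def, mul_assoc]
      rw [this]
      exact (heightFiltration G T eX b m).mul_mem hc hyx
  exact mem_normalizer_of_map_conj_le (key g hg) (key g⁻¹ ((rootSubgroup G T _).inv_mem hg))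

/-- Granted 8.1.1 (i) and 8.2.3: `(U_m, U_m) ≤ U_{m+1}` for `m ≥ 1`. [folklore] -/
theorem commutator_heightFiltration_le
    (hU : rootSubgroup_unique (G := G) (T := T))
    (hC : rootSubgroup_commutator_le (G := G) (T := T) (ι := ι) (X := X) (Y := Y))
    (hG : IsConnectedReductive G) (hT : IsMaximalTorusIn T G) (h : IsRootDatumOf G T P eX eY)
    {m : ℤ} (hm : 1 ≤ m) :
    ⁅heightFiltration G T eX b m, heightFiltration G T eX b m⁆ ≤
      heightFiltration G T eX b (m + 1) := by
  refine commutator_iSup_iSup_le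
    (fun x => rootSubgroup_le_normalizer_heightFiltration b hC hG hT h x.2.1 (m + 1))
    (fun x => rootSubgroup_le_normalizer_heightFiltration b hC hG hT h x.2.1 (m + 1))
    fun x y => ?_
  by_cases hxy : x.1 = y.1
  · have hxy' : charOfWeight eX (P.root y.1) = charOfWeight eX (P.root x.1) := by rw [hxy]
    rw [hxy', h.commutator_rootSubgroup_self hU hG hT x.1]
    exact bot_le
  · refine (commutator_rootSubgroup_le_heightFiltration b hC hG hT h x.2.1 y.2.1 hxy).trans
      (heightFiltration_mono b ?_)
    linarith [x.2.2, y.2.2]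

/-- Granted 8.1.1 (i) and 8.2.3: the derived series of `U⁺ = U_1` descends along the height
filtration, `Dʲ U_1 ≤ U_{j+1}`. [folklore] -/
theorem derivedSub_heightFiltration_one_le
    (hU : rootSubgroup_unique (G := G) (T := T))
    (hC : rootSubgroup_commutator_le (G := G) (T := T) (ι := ι) (X := X) (Y := Y))
    (hG : IsConnectedReductive G) (hT : IsMaximalTorusIn T G) (h : IsRootDatumOf G T P eX eY)
    (j : ℕ) : derivedSub (heightFiltration G T eX b 1) j ≤ heightFiltration G T eX b (j + 1) := by
  induction j with
  | zero => simp
  | succ j ih =>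
    rw [derivedSub_succ]
    refine (Subgroup.commutator_mono ih ih).trans ?_
    have := commutator_heightFiltration_le b hU hC hG hT h (m := (j : ℤ) + 1) (by omega)
    push_cast at this ⊢
    rwa [add_assoc] 

/-- **`U⁺ = ⟨U_α : α ∈ R⁺(b)⟩` is solvable**, granted Springer 8.1.1 (i) (`rootSubgroup_unique`) and
8.2.3 (`rootSubgroup_commutator_le`): the derived series descends along the (finite) height
filtration. (Springer 8.2.4 (i), proof: `U_1` is even a connected unipotent group.) [folklore] -/
theorem isSolvable_iSup_rootSubgroup_of
    (hU : rootSubgroup_unique (G := G) (T := T))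
    (hC : rootSubgroup_commutator_le (G := G) (T := T) (ι := ι) (X := X) (Y := Y))
    (hG : IsConnectedReductive G) (hT : IsMaximalTorusIn T G) (h : IsRootDatumOf G T P eX eY) :
    IsSolvable ↥(⨆ (i : ι) (_ : b.IsPos i), rootSubgroup G T (charOfWeight eX (P.root i))) := by
  haveI := h.finite_index hG hT
  rw [← heightFiltration_one]
  -- heights are bounded
  obtain ⟨M, hM⟩ := (Set.finite_range b.height).bddAbove
  have hMi : ∀ i, b.height i < (M.toNat : ℤ) + 1 := fun i =>
    lt_of_le_of_lt ((hM ⟨i, rfl⟩).trans (Int.self_le_toNat M)) (lt_add_one _)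
  refine isSolvable_of_derivedSub_eq_bot (m := M.toNat) ?_
  refine le_bot_iff.1 ((derivedSub_heightFiltration_one_le b hU hC hG hT h M.toNat).trans ?_)
  rw [heightFiltration_eq_bot b hMi]

/-- **`T · U⁺` is solvable** (Springer 8.2.4 (i), solvability clause: *`B̃ = T.U_1` is a closed,
connected, solvable subgroup*), granted 8.1.1 (i) and 8.2.3: `U⁺` is solvable and normalised by
the commutative group `T`, so the derived group of `T ⊔ U⁺` lies in `U⁺`.
[cite: SpringerLAG1998, Prop 8.2.4 (i) proof] -/
theorem isSolvable_sup_iSup_rootSubgroup_of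
    (hU : rootSubgroup_unique (G := G) (T := T))
    (hC : rootSubgroup_commutator_le (G := G) (T := T) (ι := ι) (X := X) (Y := Y))
    (hG : IsConnectedReductive G) (hT : IsMaximalTorusIn T G) (h : IsRootDatumOf G T P eX eY) :
    IsSolvable ↥(T ⊔ ⨆ (i : ι) (_ : b.IsPos i), rootSubgroup G T (charOfWeight eX (P.root i))) := by
  haveI := h.finite_index hG hT
  set U : Subgroup (GL n k) :=
    ⨆ (i : ι) (_ : b.IsPos i), rootSubgroup G T (charOfWeight eX (P.root i)) with hUdef
  have hU1 : U = heightFiltration G T eX b 1 := (heightFiltration_one b).symm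
  -- `T` and `U` normalise `U`
  have hTU : T ≤ Subgroup.normalizer (U : Set (GL n k)) := by
    rw [hU1]; exact le_normalizer_heightFiltration b 1
  have hUU : U ≤ Subgroup.normalizer (U : Set (GL n k)) := Subgroup.le_normalizer
  -- the derived group of `T ⊔ U` lies in `U`
  have hD : ⁅T ⊔ U, T ⊔ U⁆ ≤ U := by
    rw [sup_eq_iSup]
    refine commutator_iSup_iSup_le (fun c => by cases c <;> assumption)
      (fun c => by cases c <;> assumption) fun c d => ?_
    cases c <;> cases d <;> simp only [cond_true, cond_false]
    · exact commutator_le_of_le_normalizer hUU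
    · rw [Subgroup.commutator_comm]; exact commutator_le_of_le_normalizer hTU
    · exact commutator_le_of_le_normalizer hTU
    · rw [(Subgroup.commutator_self_eq_bot_iff).2 inferInstance]; exact bot_le
  -- conclude along the derived series of `U`
  obtain ⟨M, hM⟩ := (Set.finite_range b.height).bddAbove
  have hMi : ∀ i, b.height i < (M.toNat : ℤ) + 1 := fun i =>
    lt_of_le_of_lt ((hM ⟨i, rfl⟩).trans (Int.self_le_toNat M)) (lt_add_one _)
  refine isSolvable_of_derivedSub_eq_bot (m := M.toNat + 1) (le_bot_iff.1 ?_)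
  calc derivedSub (T ⊔ U) (M.toNat + 1) ≤ derivedSub U M.toNat :=
        derivedSub_succ_le_of_commutator_le hD M.toNat
    _ ≤ heightFiltration G T eX b (M.toNat + 1) := by
        rw [hU1]; exact derivedSub_heightFiltration_one_le b hU hC hG hT h M.toNat
    _ = ⊥ := heightFiltration_eq_bot b hMi

end RootDatum

end Solvable

end Literature.NumberTheory.Automorphic
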